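import Mathlib
import Summits.Ventures.PercRepro2.Defs
import Summits.Ventures.PercRepro2.Harris
import Summits.Ventures.PercRepro2.CoinDefs
import Summits.Ventures.PercRepro2.CoinReverse
import Summits.Ventures.PercRepro2.CoinStarAlg
import Summits.Ventures.PercRepro2.CoinLsmCoreAlg
import Summits.Ventures.PercRepro2.CoinLsmCoreDefs
import Summits.Ventures.PercRepro2.CoinLsmCoreMass
import Summits.Ventures.PercRepro2.CoinLsmCoreU
import Summits.Ventures.PercRepro2.CoinLsmCoreMainU

/-!
# Row 2′DARC over a closed-in core from the `u`-CELL BRACKET alone (blind cell PercRepro2, night-2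
g8; proofs/NIGHT2-DARC.md §31.4)

`darc_of_uCellLsmU` (g7) proves the row at every head over a closed-in core whose `u`-cell cluster
law is log-supermodular: the `u`-absent cell of `star_alg` is closed by directed BHK on `R_{t,u}` and
the Lemma-A shift (theorems of the coin system), the `u`-present gate cell by FKG and Holley — the
only place the lattice hypothesis enters.  When the tail `u` is an OR-vertex of the core the
`u`-cell is not ∩-closed and its covariance is negative (§30.11), but the whole cell BRACKET
`Λ² (M' XY' − X' Y') + (Λ X' − F̄_a M')(Λ Y' − F̄_b M')` can still be nonnegative (the shift product
compensates).  `darc_of_uCellBracketU` isolates exactly this: the row follows from the bracket,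
stated on the core sums.  `star_alg_bracket` is the sign lemma with the `u`-cell bracket as a
hypothesis.
-/

namespace Summit.Ventures.PercRepro2.Coin

open Classical

section CoreBracketU

variable {V : Type*} {E : Type*} [Fintype V] [DecidableEq V] [Fintype E] [DecidableEq E]
  {R : Type*} [Field R] [LinearOrder R] [IsStrictOrderedRing R]
  {arcs : E → Finset (V × V)} {s : V} {C : Finset V}

omit [Fintype V] [DecidableEq V] [Fintype E] [DecidableEq E] in
/-- **The two-cell sign lemma with the `u`-cell bracket as a hypothesis** (`q = r = 1`): with
`Λ = M₀ + M₁`, `F̄_a = X₀ + X₁`, `F̄_b = Y₀ + Y₁`, the cleared gate functional is nonnegative as soon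
as the `u`-absent cell has a nonnegative covariance (`X₀ Y₀ ≤ M₀ XY₀`) and means below the `R`-means
(`m₀ ≤ m₁`, both markers), and the `u`-present gate cell bracket
`Λ² (M' XY' − X' Y') + (Λ X' − F̄_a M')(Λ Y' − F̄_b M')` is nonnegative. -/
theorem star_alg_bracket (M₀ X₀ Y₀ XY₀ M₁ X₁ Y₁ M' X' Y' XY' : R)
    (hM₀ : 0 < M₀) (hM' : 0 < M')
    (hF₀ : X₀ * Y₀ ≤ M₀ * XY₀)
    (h01x : X₀ * M₁ ≤ M₀ * X₁) (h01y : Y₀ * M₁ ≤ M₀ * Y₁)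
    (hP' : 0 ≤ (M₀ + M₁) ^ 2 * (M' * XY' - X' * Y')
      + ((M₀ + M₁) * X' - (X₀ + X₁) * M') * ((M₀ + M₁) * Y' - (Y₀ + Y₁) * M')) :
    0 ≤ (M₀ + M₁) ^ 2 * (XY₀ + XY')
        - (M₀ + M₁) * (X₀ + X₁) * (Y₀ + Y')
        - (M₀ + M₁) * (Y₀ + Y₁) * (X₀ + X')
        + (X₀ + X₁) * (Y₀ + Y₁) * (M₀ + M') := by
  set Λ := M₀ + M₁ with hΛ
  set Fa := X₀ + X₁ with hFa
  set Fb := Y₀ + Y₁ with hFb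
  have key : (Λ ^ 2 * (XY₀ + XY') - Λ * Fa * (Y₀ + Y') - Λ * Fb * (X₀ + X')
      + Fa * Fb * (M₀ + M')) * (M₀ * M') =
      M' * (Λ ^ 2 * (M₀ * XY₀ - X₀ * Y₀) + (Λ * X₀ - Fa * M₀) * (Λ * Y₀ - Fb * M₀))
      + M₀ * (Λ ^ 2 * (M' * XY' - X' * Y') + (Λ * X' - Fa * M') * (Λ * Y' - Fb * M')) := by
    simp only [hΛ, hFa, hFb]; ring
  have hs0x : Λ * X₀ - Fa * M₀ = X₀ * M₁ - M₀ * X₁ := by simp only [hΛ, hFa]; ring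
  have hs0y : Λ * Y₀ - Fb * M₀ = Y₀ * M₁ - M₀ * Y₁ := by simp only [hΛ, hFb]; ring
  have hx0 : Λ * X₀ - Fa * M₀ ≤ 0 := by rw [hs0x]; linarith
  have hy0 : Λ * Y₀ - Fb * M₀ ≤ 0 := by rw [hs0y]; linarith
  have hP₀ : 0 ≤ Λ ^ 2 * (M₀ * XY₀ - X₀ * Y₀) + (Λ * X₀ - Fa * M₀) * (Λ * Y₀ - Fb * M₀) :=
    add_nonneg (mul_nonneg (sq_nonneg _) (by linarith)) (mul_nonneg_of_nonpos_of_nonpos hx0 hy0)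
  have hprod : 0 ≤ (Λ ^ 2 * (XY₀ + XY') - Λ * Fa * (Y₀ + Y') - Λ * Fb * (X₀ + X')
      + Fa * Fb * (M₀ + M')) * (M₀ * M') := by
    rw [key]
    exact add_nonneg (mul_nonneg hM'.le hP₀) (mul_nonneg hM₀.le hP')
  exact nonneg_of_mul_nonneg_left hprod (mul_pos hM₀ hM')

/-- **THEOREM (row 2′DARC over a closed-in core with pairs at the root, every head, from the
`u`-CELL BRACKET)** — `darc_of_uCellLsmU` with the log-supermodularity of the `u`-cell replaced by
its consequence that the proof actually uses: the `u`-cell bracket of `star_alg`,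
`Λ² (M' XY' − X' Y') + (Λ X' − F̄_a M')(Λ Y' − F̄_b M') ≥ 0`, stated on the core sums
(`μ₀ = ν·1[u ∉ ·]·A`, `μ₁ = ν·1[u ∈ ·]·A`, `μ' = ν·1[u ∈ ·]·A(· ∪ w)`; `Λ = M₀ + M₁`,
`F̄ = X₀ + X₁`).  The `u`-absent cell is handled by the theorems of the coin system (directed BHK on
`R_{t,u}` and the Lemma-A shift), exactly as there; nothing is assumed about the `u`-cell beyond the
bracket — which for the OR-tail of the undirected square is (OR) (`CoinSquareAlg.lean`). -/
theorem darc_of_uCellBracketU (p : E → R) (hp : IsProbVec p) (hS : SameEnds arcs)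
    (h : ClosedInCoreU arcs s C) {t : V} (htC : t ∉ C) (hts : t ≠ s) {a b u w : V}
    (ha : a ∈ C) (hb : b ∈ C) (hu : u ∈ C) (hws : w ≠ s) (hwC : w ∉ C)
    (hP' : 0 ≤ ((∑ W ∈ C.powerset, prob p (coreLevel arcs s C W) * notMemWt u W * prob p (coreAvoidEvent arcs s t C W)) + (∑ W ∈ C.powerset, prob p (coreLevel arcs s C W) * memWt u W * prob p (coreAvoidEvent arcs s t C W))) ^ 2 * ((∑ W ∈ C.powerset, prob p (coreLevel arcs s C W) * memWt u W * prob p (coreAvoidEvent arcs s t C (insert w W))) * (∑ W ∈ C.powerset, prob p (coreLevel arcs s C W) * memWt u W * prob p (coreAvoidEvent arcs s t C (insert w W)) * ((if a ∈ W then (1 : R) else 0) * (if b ∈ W then (1 : R) else 0))) - (∑ W ∈ C.powerset, prob p (coreLevel arcs s C W) * memWt u W * prob p (coreAvoidEvent arcs s t C (insert w W)) * (if a ∈ W then (1 : R) else 0)) * (∑ W ∈ C.powerset, prob p (coreLevel arcs s C W) * memWt u W * prob p (coreAvoidEvent arcs s t C (insert w W)) * (if b ∈ W then (1 : R) else 0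)))
      + (((∑ W ∈ C.powerset, prob p (coreLevel arcs s C W) * notMemWt u W * prob p (coreAvoidEvent arcs s t C W)) + (∑ W ∈ C.powerset, prob p (coreLevel arcs s C W) * memWt u W * prob p (coreAvoidEvent arcs s t C W))) * (∑ W ∈ C.powerset, prob p (coreLevel arcs s C W) * memWt u W * prob p (coreAvoidEvent arcs s t C (insert w W)) * (if a ∈ W then (1 : R) else 0)) - ((∑ W ∈ C.powerset, prob p (coreLevel arcs s C W) * notMemWt u W * prob p (coreAvoidEvent arcs s t C W) * (if a ∈ W then (1 : R) else 0)) + (∑ W ∈ C.powerset, prob p (coreLevel arcs s C W) * memWt u W * prob p (coreAvoidEvent arcs s t C W) * (if a ∈ W then (1 : R) else 0))) * (∑ W ∈ C.powerset, prob p (coreLevel arcs s C W) * memWt u W * prob p (coreAvoidEvent arcs s t C (insert w W))))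
        * (((∑ W ∈ C.powerset, prob p (coreLevel arcs s C W) * notMemWt u W * prob p (coreAvoidEvent arcs s t C W)) + (∑ W ∈ C.powerset, prob p (coreLevel arcs s C W) * memWt u W * prob p (coreAvoidEvent arcs s t C W))) * (∑ W ∈ C.powerset, prob p (coreLevel arcs s C W) * memWt u W * prob p (coreAvoidEvent arcs s t C (insert w W)) * (if b ∈ W then (1 : R) else 0)) - ((∑ W ∈ C.powerset, prob p (coreLevel arcs s C W) * notMemWt u W * prob p (coreAvoidEvent arcs s t C W) * (if b ∈ W then (1 : R) else 0)) + (∑ W ∈ C.powerset, prob p (coreLevel arcs s C W) * memWt u W * prob p (coreAvoidEvent arcs s t C W) * (if b ∈ W then (1 : R) else 0))) * (∑ W ∈ C.powerset, prob p (coreLevel arcs s C W) * memWt u W * prob p (coreAvoidEvent arcs s t C (insert w W)))))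
    (hM₀ : 0 < ∑ W ∈ C.powerset, prob p (coreLevel arcs s C W) * notMemWt u W *
      prob p (coreAvoidEvent arcs s t C W))
    (hM' : 0 < ∑ W ∈ C.powerset, prob p (coreLevel arcs s C W) * memWt u W *
      prob p (coreAvoidEvent arcs s t C (insert w W))) :
    DARC p arcs s {t} a b u w := by
  set ν : Finset V → R := fun W => prob p (coreLevel arcs s C W) with hνdef
  set A : Finset V → R := fun X => prob p (coreAvoidEvent arcs s t C X) with hA
  set x : Finset V → R := fun W => if a ∈ W then 1 else 0 with hx
  set y : Finset V → R := fun W => if b ∈ W then 1 else 0 with hy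
  set X : Config E → R := marker (R := R) arcs s a with hX
  set Y : Config E → R := marker (R := R) arcs s b with hY
  have hxc : ∀ W ⊆ C, ∀ ω ∈ coreLevel arcs s C W, X ω = x W :=
    fun W _ ω hω => marker_on_coreLevel ha hω
  have hyc : ∀ W ⊆ C, ∀ ω ∈ coreLevel arcs s C W, Y ω = y W :=
    fun W _ ω hω => marker_on_coreLevel hb hω
  have hxyc : ∀ W ⊆ C, ∀ ω ∈ coreLevel arcs s C W, (fun ω => X ω * Y ω) ω = x W * y W :=
    fun W hW ω hω => by simp only [hxc W hW ω hω, hyc W hW ω hω]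
  have h1c : ∀ W ⊆ C, ∀ ω ∈ coreLevel arcs s C W,
      (fun _ : Config E => (1 : R)) ω = (fun _ => (1 : R)) W := fun _ _ _ _ => rfl
  -- the indicator of `u ∉ S⁺` on a level
  have huc : ∀ W ⊆ C, ∀ ω ∈ coreLevel arcs s C W,
      (fwdEvent arcs s u)ᶜ.indicator (1 : Config E → R) ω = notMemWt u W := by
    intro W _ ω hω
    have hmem : ω ∈ fwdEvent arcs s u ↔ u ∈ W := by
      simp only [fwdEvent, Set.mem_setOf_eq]
      exact (mem_coreLevel.mp hω u hu).symm
    simp only [notMemWt]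
    by_cases huW : u ∈ W
    · have hn : ω ∉ (fwdEvent arcs s u)ᶜ := fun h' => h' (hmem.mpr huW)
      rw [if_pos huW, Set.indicator_of_notMem hn]
    · have hm : ω ∈ (fwdEvent arcs s u)ᶜ := fun h' => huW (hmem.mp h')
      rw [if_neg huW, Set.indicator_of_mem hm]; rfl
  have hR := h.avoid_eq_biUnion hS htC hts
  have hG := h.gate_eq_biUnion hS htC hts hu hwC hws
  have hsplitG : ∀ g : Finset V → R,
      ∑ W ∈ C.powerset, g W * (ν W * A (starTarget u w W)) =
        ∑ W ∈ C.powerset, ν W * notMemWt u W * A W * g W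
          + ∑ W ∈ C.powerset, ν W * memWt u W * A (insert w W) * g W := by
    intro g
    rw [← Finset.sum_add_distrib]
    refine Finset.sum_congr rfl fun W _ => ?_
    rw [starTarget_split u w A W]; ring
  -- the `R`-masses, the gate masses, and the `R_{t,u}`-masses
  have hPR : prob p (avoidEvent arcs s {t}) = ∑ W ∈ C.powerset, ν W * A W := by
    rw [prob_eq_massE_one, hR, h.core_mass p t (fun W => W) h1c]
    simp only [one_mul]
    rfl
  have hXR : massE p X (avoidEvent arcs s {t}) = ∑ W ∈ C.powerset, ν W * A W * x W := by
    rw [hR, h.core_mass p t (fun W => W) hxc]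
    exact Finset.sum_congr rfl fun W _ => by ring
  have hYR : massE p Y (avoidEvent arcs s {t}) = ∑ W ∈ C.powerset, ν W * A W * y W := by
    rw [hR, h.core_mass p t (fun W => W) hyc]
    exact Finset.sum_congr rfl fun W _ => by ring
  have hPG : prob p (gateEvent arcs s {t} u w) =
      ∑ W ∈ C.powerset, ν W * notMemWt u W * A W
        + ∑ W ∈ C.powerset, ν W * memWt u W * A (insert w W) := by
    rw [prob_eq_massE_one, hG, h.core_mass p t (starTarget u w) h1c, hsplitG]
    simp only [mul_one]
  have hXG : massE p X (gateEvent arcs s {t} u w) =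
      ∑ W ∈ C.powerset, ν W * notMemWt u W * A W * x W
        + ∑ W ∈ C.powerset, ν W * memWt u W * A (insert w W) * x W := by
    rw [hG, h.core_mass p t (starTarget u w) hxc, hsplitG]
  have hYG : massE p Y (gateEvent arcs s {t} u w) =
      ∑ W ∈ C.powerset, ν W * notMemWt u W * A W * y W
        + ∑ W ∈ C.powerset, ν W * memWt u W * A (insert w W) * y W := by
    rw [hG, h.core_mass p t (starTarget u w) hyc, hsplitG]
  have hXYG : massE p (fun ω => X ω * Y ω) (gateEvent arcs s {t} u w) =
      ∑ W ∈ C.powerset, ν W * notMemWt u W * A W * (x W * y W)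
        + ∑ W ∈ C.powerset, ν W * memWt u W * A (insert w W) * (x W * y W) := by
    rw [hG, h.core_mass p t (starTarget u w) hxyc, hsplitG]
  -- the `R_{t,u} = {u ∉ S⁺} ∩ R_t` masses
  have hRu : avoidEvent arcs s (insert u {t}) = (fwdEvent arcs s u)ᶜ ∩ avoidEvent arcs s {t} :=
    avoidEvent_insert arcs s u {t}
  have hPRu : prob p (avoidEvent arcs s (insert u {t})) =
      ∑ W ∈ C.powerset, ν W * notMemWt u W * A W := by
    rw [prob_eq_massE_one, hRu, massE_inter_left, hR,
      h.core_mass p t (fun W => W) (g := fun W => notMemWt u W)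
        (fun W hW ω hω => by simp only [mul_one]; exact huc W hW ω hω)]
    exact Finset.sum_congr rfl fun W _ => by ring
  have hXRu : massE p X (avoidEvent arcs s (insert u {t})) =
      ∑ W ∈ C.powerset, ν W * notMemWt u W * A W * x W := by
    rw [hRu, massE_inter_left, hR,
      h.core_mass p t (fun W => W) (g := fun W => notMemWt u W * x W)
        (fun W hW ω hω => by rw [huc W hW ω hω, hxc W hW ω hω])]
    exact Finset.sum_congr rfl fun W _ => by ring
  have hYRu : massE p Y (avoidEvent arcs s (insert u {t})) =
      ∑ W ∈ C.powerset, ν W * notMemWt u W * A W * y W := by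
    rw [hRu, massE_inter_left, hR,
      h.core_mass p t (fun W => W) (g := fun W => notMemWt u W * y W)
        (fun W hW ω hω => by rw [huc W hW ω hω, hyc W hW ω hω])]
    exact Finset.sum_congr rfl fun W _ => by ring
  have hXYRu : massE p (fun ω => X ω * Y ω) (avoidEvent arcs s (insert u {t})) =
      ∑ W ∈ C.powerset, ν W * notMemWt u W * A W * (x W * y W) := by
    rw [hRu, massE_inter_left, hR,
      h.core_mass p t (fun W => W) (g := fun W => notMemWt u W * (x W * y W))
        (fun W hW ω hω => by simp only [huc W hW ω hω, hxc W hW ω hω, hyc W hW ω hω])]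
    exact Finset.sum_congr rfl fun W _ => by ring
  -- the `u`-absent cell: directed BHK and the Lemma-A shift (theorems of the coin system)
  set μ₀ : Finset V → R := fun W => ν W * notMemWt u W * A W with hμ₀
  set μ₁ : Finset V → R := fun W => ν W * memWt u W * A W with hμ₁
  set μ' : Finset V → R := fun W => ν W * memWt u W * A (insert w W) with hμ'
  have hsplit : ∀ g : Finset V → R, ∑ W ∈ C.powerset, ν W * A W * g W =
      ∑ W ∈ C.powerset, μ₀ W * g W + ∑ W ∈ C.powerset, μ₁ W * g W := by
    intro g
    rw [← Finset.sum_add_distrib]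
    refine Finset.sum_congr rfl fun W _ => ?_
    simp only [hμ₀, hμ₁, notMemWt, memWt]
    split_ifs <;> ring
  have hsplit1 : ∑ W ∈ C.powerset, ν W * A W =
      ∑ W ∈ C.powerset, μ₀ W + ∑ W ∈ C.powerset, μ₁ W := by
    have := hsplit (fun _ => 1)
    simpa only [mul_one] using this
  have hF₀ : (∑ W ∈ C.powerset, μ₀ W * x W) * ∑ W ∈ C.powerset, μ₀ W * y W ≤
      (∑ W ∈ C.powerset, μ₀ W) * ∑ W ∈ C.powerset, μ₀ W * (x W * y W) := by
    have hc := covC_nonneg p hp hS s a b (insert u {t})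
    simp only [covC] at hc
    rw [hPRu, hXRu, hYRu, hXYRu] at hc
    linarith
  have hshx : (∑ W ∈ C.powerset, μ₀ W * x W) * ∑ W ∈ C.powerset, μ₁ W ≤
      (∑ W ∈ C.powerset, μ₀ W) * ∑ W ∈ C.powerset, μ₁ W * x W := by
    have hsh := shift_avoid_more_C p hp hS s a (U := {t}) (U' := insert u {t})
      (Finset.subset_insert _ _)
    rw [hXRu, hPR, hXR, hPRu, hsplit1, hsplit x] at hsh
    nlinarith [hsh]
  have hshy : (∑ W ∈ C.powerset, μ₀ W * y W) * ∑ W ∈ C.powerset, μ₁ W ≤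
      (∑ W ∈ C.powerset, μ₀ W) * ∑ W ∈ C.powerset, μ₁ W * y W := by
    have hsh := shift_avoid_more_C p hp hS s b (U := {t}) (U' := insert u {t})
      (Finset.subset_insert _ _)
    rw [hYRu, hPR, hYR, hPRu, hsplit1, hsplit y] at hsh
    nlinarith [hsh]
  have key := star_alg_bracket (∑ W ∈ C.powerset, μ₀ W) (∑ W ∈ C.powerset, μ₀ W * x W)
    (∑ W ∈ C.powerset, μ₀ W * y W) (∑ W ∈ C.powerset, μ₀ W * (x W * y W))
    (∑ W ∈ C.powerset, μ₁ W) (∑ W ∈ C.powerset, μ₁ W * x W) (∑ W ∈ C.powerset, μ₁ W * y W)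
    (∑ W ∈ C.powerset, μ' W) (∑ W ∈ C.powerset, μ' W * x W) (∑ W ∈ C.powerset, μ' W * y W)
    (∑ W ∈ C.powerset, μ' W * (x W * y W)) hM₀ hM' hF₀ hshx hshy hP'
  unfold DARC phiC
  simp only
  rw [hPR, hXR, hYR, hPG, hXG, hYG, hXYG, hsplit1, hsplit x, hsplit y]
  exact key

end CoreBracketU

end Summit.Ventures.PercRepro2.Coin
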